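import Mathlib.Tactic
import Literature.Computability.Cryptography.ClassBQPReductionProofs
import Literature.Computability.QuantumComplexity.ForrelationComplete
import Literature.Computability.Complexity.BPClosureProofs
import Literature.Computability.Complexity.Promise
import Literature.Computability.Complexity.Reductions
import Literature.Computability.Cryptography.ClassBQP
import Summits.QuantumAdvantage.QuantumAdvantage.Statement
import Summits.QuantumAdvantage.QuantumAdvantage.Theorems.SoloInformedPseudoDeterministicLift
import HarnessLib

/-!
# SoloInformedHardLanguage — `Q-EXT` ⟺ `BQP` contains a `PromiseBQP`-hard language

Solo seat `solo-QuantumAdvantage-informed` (ideation tier, summit-directed). The lift hypothesis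
`Q-EXT := PromiseBQP ⊆ promiseLift BQP` of the seat's door, read through Karp reductions of promise
problems (`PromiseProblem.PolyTimeReducible`, Goldreich 2006 Def. 1.4):

* `mem_promiseLift_BQP_of_polyTimeReducible_ofLanguage` — a promise problem that Karp-reduces to (the
  trivial-promise problem of) a `BQP` language is solved by a `BQP` language (the preimage;
  `mem_PromiseBQP_of_polyTimeReducible`); `mem_BQP_of_karpReducible_BQP` — `BQP` is closed downward under `≤ₚ`;
* `promiseIsLift_of_hardLanguage` — **a `PromiseBQP`-hard language in `BQP` gives `Q-EXT`** (unconditional);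
* `hardLanguage_of_promiseIsLift` — conversely, under `Q-EXT` any `BQP` completion of a `PromiseBQP`-complete
  promise problem is a `PromiseBQP`-hard language; hence, taking Aaronson–Ambainis' complete problem
  (named fact `aaronson_ambainis_kForrelation_complete`: explicit poly-fold FORRELATION),
  **`promiseIsLift_iff_hardLanguage : Q-EXT ↔ ∃ L ∈ BQP, ∀ Q ∈ PromiseBQP, Q ≤ₚ ofLanguage L`** and
  **`promiseIsLift_iff_kForrelation_lifts : Q-EXT ↔ kForrelationProblem ∈ promiseLift BQP`** — the whole lift
  hypothesis is the statement that ONE explicit promise problem agrees with a `BQP` language on its promise;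
* `exists_complete_language_of_promiseIsLift` — **`Q-EXT ⇒ BQP` has a Karp-complete LANGUAGE** (a complete
  problem "with vacuous promise"; for the sister semantic class `QMA` Watrous writes that this "would be
  surprising", and for `BPP` it fails relative to an oracle, Sipser 1982 — so `Q-EXT` is, like the summit,
  beyond relativizing technique, cf. `Literature.Barriers.QuantumAdvantage.PromiseLiftRelativization`);
* `quantumAdvantage_iff_not_mem_BPP_of_complete` — with a `BQP`-complete language `L` in hand the summit is
  the single non-membership `L ∉ BPP` (`mem_BPP_of_karpReducible`).

[cite: Goldreich2006, Def. 1.2 and Def. 1.4] [cite: AaronsonAmbainis2018, §1.2 and §6 (Prop. 6, Thm. 25)]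
[cite: Watrous2009, §IV.1–IV.3 (promise problems; complete problems with vacuous promise)]
[cite: AroraBarakCC2009, §7.6 (Def. 7.16)]
-/

noncomputable section

namespace Summit.QuantumAdvantage.QuantumAdvantage.Theorems

open _root_.Computability Literature.Computability.Complexity Literature.Computability.Cryptography
  Literature.Computability.QuantumComplexity
open scoped Literature.Computability.Complexity.Notation

/-- **`BQP` is closed downward under Karp reductions** (`L₁ ≤ₚ L₂ ∈ BQP ⇒ L₁ ∈ BQP`), from the closure of
`PromiseBQP` under Karp reductions of promise problems (`mem_PromiseBQP_of_polyTimeReducible`) applied to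
the trivial-promise problems. [cite: Watrous2009, §IV.3] [cite: Goldreich2006, Def. 1.4] -/
theorem mem_BQP_of_karpReducible_BQP {L₁ L₂ : Language Bool} (h : L₁ ≤ₚ L₂) (h₂ : L₂ ∈ BQP) :
    L₁ ∈ BQP := by
  obtain ⟨f, hf, hfL⟩ := h
  have hred : (PromiseProblem.ofLanguage L₁).PolyTimeReducible (PromiseProblem.ofLanguage L₂) :=
    ⟨f, hf, fun x hx => (hfL x).1 hx, fun x hx => fun h => hx ((hfL x).2 h)⟩
  exact ofLanguage_mem_PromiseBQP_iff.1
    (mem_PromiseBQP_of_polyTimeReducible hred (ofLanguage_mem_PromiseBQP_iff.2 h₂))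

/-- **A promise problem Karp-reducible to a `BQP` language lifts**: if `Q ≤ₚ ofLanguage L` with `L ∈ BQP`
then the preimage `f⁻¹(L) ∈ BQP` solves `Q`, so `Q ∈ promiseLift BQP`.
[cite: Goldreich2006, Def. 1.2 and Def. 1.4] [cite: Watrous2009, §IV.3] -/
theorem mem_promiseLift_BQP_of_polyTimeReducible_ofLanguage {Q : PromiseProblem} {L : Language Bool}
    (h : Q.PolyTimeReducible (PromiseProblem.ofLanguage L)) (hL : L ∈ BQP) : Q ∈ promiseLift BQP := by
  obtain ⟨f, hf, hfy, hfn⟩ := h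
  have hpre : (f ⁻¹' L : Set (List Bool)) ∈ BQP :=
    mem_BQP_of_karpReducible_BQP ⟨f, hf, fun _ => Iff.rfl⟩ hL
  exact ⟨f ⁻¹' L, hpre, fun x hx => hfy hx, fun x hx => hfn hx⟩

/-- **A `PromiseBQP`-hard language in `BQP` gives `Q-EXT`** (unconditional): every `PromiseBQP` problem
reduces to `ofLanguage L` and therefore lifts. [cite: Goldreich2006, Def. 1.4] [cite: Watrous2009, §IV.3] -/
theorem promiseIsLift_of_hardLanguage {L : Language Bool} (hL : L ∈ BQP)
    (hhard : ∀ Q ∈ PromiseBQP, Q.PolyTimeReducible (PromiseProblem.ofLanguage L)) :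
    PromiseBQP ⊆ promiseLift BQP := fun Q hQ =>
  mem_promiseLift_BQP_of_polyTimeReducible_ofLanguage (hhard Q hQ) hL

/-- **A `BQP` completion of a `PromiseBQP`-complete problem is a `PromiseBQP`-hard language**: the
reductions to `Π` are reductions to `ofLanguage L` because `L` agrees with `Π` on the promise.
[cite: Goldreich2006, Def. 1.2 and Def. 1.4] -/
theorem hardLanguage_of_complete_lifts {Pc : PromiseProblem} (hlift : Pc ∈ promiseLift BQP)
    (hhard : ∀ Q ∈ PromiseBQP, Q.PolyTimeReducible Pc) :
    ∃ L ∈ BQP, ∀ Q ∈ PromiseBQP, Q.PolyTimeReducible (PromiseProblem.ofLanguage L) := by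
  obtain ⟨L, hL, hyes, hno⟩ := hlift
  refine ⟨L, hL, fun Q hQ => ?_⟩
  obtain ⟨f, hf, hfy, hfn⟩ := hhard Q hQ
  exact ⟨f, hf, fun x hx => hyes (hfy hx), fun x hx => hno (hfn hx)⟩

/-- Under `Q-EXT` a `PromiseBQP`-complete problem lifts, so `BQP` contains a `PromiseBQP`-hard language.
[cite: Goldreich2006, Def. 1.2 and Def. 1.4] -/
theorem hardLanguage_of_promiseIsLift (hExt : PromiseBQP ⊆ promiseLift BQP) {Pc : PromiseProblem}
    (hPc : Pc ∈ PromiseBQP) (hhard : ∀ Q ∈ PromiseBQP, Q.PolyTimeReducible Pc) :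
    ∃ L ∈ BQP, ∀ Q ∈ PromiseBQP, Q.PolyTimeReducible (PromiseProblem.ofLanguage L) :=
  hardLanguage_of_complete_lifts (hExt hPc) hhard

/-- **`Q-EXT` is the liftability of ONE problem**: for a `PromiseBQP`-complete `Π`,
`Q-EXT ↔ Π ∈ promiseLift BQP`. [cite: Goldreich2006, Def. 1.2 and Def. 1.4] -/
theorem promiseIsLift_iff_complete_lifts {Pc : PromiseProblem} (hPc : Pc ∈ PromiseBQP)
    (hhard : ∀ Q ∈ PromiseBQP, Q.PolyTimeReducible Pc) :
    PromiseBQP ⊆ promiseLift BQP ↔ Pc ∈ promiseLift BQP := by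
  refine ⟨fun hExt => hExt hPc, fun hlift => ?_⟩
  obtain ⟨L, hL, hhardL⟩ := hardLanguage_of_complete_lifts hlift hhard
  exact promiseIsLift_of_hardLanguage hL hhardL

/-- **`Q-EXT ⟺ BQP contains a PromiseBQP-hard language`**, given a `PromiseBQP`-complete promise problem —
here Aaronson–Ambainis' explicit poly-fold Forrelation (named fact `aaronson_ambainis_kForrelation_complete`;
the `⇐` direction is unconditional, `promiseIsLift_of_hardLanguage`).
[cite: AaronsonAmbainis2018, §1.2 and §6 (Prop. 6, Thm. 25)] [cite: Goldreich2006, Def. 1.4] -/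
theorem promiseIsLift_iff_hardLanguage (hAA : aaronson_ambainis_kForrelation_complete) :
    PromiseBQP ⊆ promiseLift BQP ↔
      ∃ L ∈ BQP, ∀ Q ∈ PromiseBQP, Q.PolyTimeReducible (PromiseProblem.ofLanguage L) :=
  ⟨fun hExt => hardLanguage_of_promiseIsLift hExt hAA.1 hAA.2,
    fun ⟨_, hL, hhard⟩ => promiseIsLift_of_hardLanguage hL hhard⟩

/-- **`Q-EXT ⟺` explicit poly-fold Forrelation agrees with a `BQP` language on its promise**
(Aaronson–Ambainis' `PromiseBQP`-complete problem as the one problem of `promiseIsLift_iff_complete_lifts`).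
[cite: AaronsonAmbainis2018, §1.2 and §6 (Prop. 6, Thm. 25)] [cite: Goldreich2006, Def. 1.2] -/
theorem promiseIsLift_iff_kForrelation_lifts (hAA : aaronson_ambainis_kForrelation_complete) :
    PromiseBQP ⊆ promiseLift BQP ↔ kForrelationProblem ∈ promiseLift BQP :=
  promiseIsLift_iff_complete_lifts hAA.1 hAA.2

/-- **`Q-EXT ⇒ BQP` has a Karp-complete language** (given a `PromiseBQP`-complete promise problem): the
completion `L` is `BQP`-hard — every `L' ∈ BQP` is `ofLanguage L' ∈ PromiseBQP`, which reduces to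
`ofLanguage L` — and `L ∈ BQP`. A complete problem "with vacuous promise" for a semantic class: for `QMA`
Watrous calls this prospect surprising; for `BPP` it fails relative to an oracle (Sipser 1982).
[cite: Watrous2009, §IV.1–IV.3] [cite: Goldreich2006, §1.1 and Def. 1.4] -/
theorem exists_complete_language_of_promiseIsLift (hExt : PromiseBQP ⊆ promiseLift BQP)
    {Pc : PromiseProblem} (hPc : Pc ∈ PromiseBQP) (hhard : ∀ Q ∈ PromiseBQP, Q.PolyTimeReducible Pc) :
    ∃ L ∈ BQP, PromiseProblem.IsHard BQP (PromiseProblem.ofLanguage L) := by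
  obtain ⟨L, hL, hh⟩ := hardLanguage_of_promiseIsLift hExt hPc hhard
  exact ⟨L, hL, fun L' hL' => hh _ (ofLanguage_mem_PromiseBQP_iff.2 hL')⟩

/-- The same with Aaronson–Ambainis' complete problem supplied. [cite: AaronsonAmbainis2018, §6 (Prop. 6, Thm. 25)] -/
theorem exists_complete_language_of_promiseIsLift' (hAA : aaronson_ambainis_kForrelation_complete)
    (hExt : PromiseBQP ⊆ promiseLift BQP) :
    ∃ L ∈ BQP, PromiseProblem.IsHard BQP (PromiseProblem.ofLanguage L) :=
  exists_complete_language_of_promiseIsLift hExt hAA.1 hAA.2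

/-- **With a `BQP`-complete language the summit is one non-membership**: if `L ∈ BQP` is `BQP`-hard under
Karp reductions then `QuantumAdvantage ↔ L ∉ BPP` (`BPP` is closed downward under `≤ₚ`,
`mem_BPP_of_karpReducible`). [cite: AroraBarakCC2009, §7.6 (Def. 7.16)] [cite: Goldreich2006, §1.1 and Def. 1.4] -/
theorem quantumAdvantage_iff_not_mem_BPP_of_complete {L : Language Bool} (hL : L ∈ BQP)
    (hhard : PromiseProblem.IsHard BQP (PromiseProblem.ofLanguage L)) :
    QuantumAdvantage ↔ L ∉ BPP := by
  constructor
  · rintro ⟨L₀, hL₀, hL₀B⟩ hLB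
    obtain ⟨f, hf, hfy, hfn⟩ := hhard L₀ hL₀
    have hred : L₀ ≤ₚ L :=
      ⟨f, hf, fun x => ⟨fun hx => hfy hx, fun hx => by_contra fun hx' => hfn hx' hx⟩⟩
    exact hL₀B (mem_BPP_of_karpReducible hred hLB)
  · exact fun hLB => ⟨L, hL, hLB⟩

/-- **Summit form.** Given a `PromiseBQP`-complete `Π` solved by a `BQP` language `L` (pointwise `Q-EXT`
at the complete problem), `QuantumAdvantage ↔ L ∉ BPP`: the language/promise gap and the summit both
collapse onto one explicit language. [cite: Goldreich2006, Def. 1.2 and Def. 1.4] [cite: AroraBarakCC2009, §7.6 (Def. 7.16)] -/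
theorem quantumAdvantage_iff_of_complete_lift {Pc : PromiseProblem}
    (hhard : ∀ Q ∈ PromiseBQP, Q.PolyTimeReducible Pc) {L : Language Bool} (hL : L ∈ BQP)
    (hyes : Pc.yes ≤ L) (hno : Pc.no ≤ Lᶜ) : QuantumAdvantage ↔ L ∉ BPP := by
  refine quantumAdvantage_iff_not_mem_BPP_of_complete hL fun L' hL' => ?_
  obtain ⟨f, hf, hfy, hfn⟩ := hhard _ (ofLanguage_mem_PromiseBQP_iff.2 hL')
  exact ⟨f, hf, fun x hx => hyes (hfy hx), fun x hx => hno (hfn hx)⟩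

end Summit.QuantumAdvantage.QuantumAdvantage.Theorems

end
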